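import Summits.CriticalPhenomena.SAWScalingLimit.Theorems.SAWSpinMonotoneQCIdentificationNoBranchingCorners
import Summits.CriticalPhenomena.SAWScalingLimit.Theorems.SAWSpinMonotoneQCIdentificationAffineDictionary
import Summits.CriticalPhenomena.SAWScalingLimit.Theorems.SAWSpinMonotoneQCIdentificationStepLawArcs

/-!
# `NoBranching`, step S4 (geometry) — hexagon corners, shared darts and flank directions (helper of
`stub_noBranching : NoFoldBound → NoBranching`, line `eight_fifths_primitive`, crux `QCIdentification`,
stmt-CriticalPhenomena-16772)

**What.** Fix a site `s` of `𝕋` and its hexagon `face s 0, …, face s 5` of `ℍ` (counterclockwise,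
`HexKernel.face`). The triangle `Δ_v` of the face `v = face s l` has a corner at `s`; in the labelling
of the corner-angle file (`NB.dart`, `NB.cornerAngle`: `cornerAngle F v k` is the interior angle of the
image triangle between the sides `dart F v k` and `dart F v (k+1)`, i.e. at the image of the vertex
`Dev.triVert v (k+1)`) this corner has index `arcCornerIdx l` (`= 1, 0, 2, 1, 0, 2`;
`triVert_face_arcCornerIdx`, and conversely every corner `(v, k)` is such a hexagon corner,
`s4_exists_face_eq_of_corner` — the regrouping dictionary of corners by sites). Its two sides are the
darts through the mid-edges towards the two hexagon neighbours,
`hexNbr (face s l) (arcCornerIdx l) = face s (l+1)` and `hexNbr (face s l) (arcCornerIdx l + 1) = face s (l-1)`,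
and the two darts through one hexagon edge are opposite (`s4_dart_shared_neg`, pure midpoint
geometry: both are `± ½ (c_{l+1} - c_l) · F`). For an arc `face s (j+1), …, face s (j+m)` the FLANK
darts — of the first face through `p_out = {face s j, face s (j+1)}` and of the last face through
`p_in = {face s (j+1+m), face s (j+m)}` — are `½ (c_u - c_v) · F(p)` (`s4_flank_dart_out/in`), the two
flank directions differ by the exterior angle of the arc,
`arg (c(face s j) - c(face s (j+1))) - arg (c(face s (j+1+m)) - c(face s (j+m))) ≡ π - m·π/3 (mod 2π)`
(`s4_flank_direction`; the same `τ_m` as the boundary step law `StepLaw.sl_boundary_winding_step`,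
`W(p_out) - W(p_in) = π - m·π/3`), hence
`arg g_out - arg g_in ≡ (π - m·π/3) + (arg F(p_out) - arg F(p_in))` (`s4_flank_phase`).

**Why.** Per-site boundary bookkeeping of the combinatorial Gauss–Bonnet count proving `NoBranching`;
the companion file `…NoBranchingArcs` sums the corner angles along an arc. Conventions validated by
exact enumeration (work file `scratch_s4/s4_check.py`: 1 218 arcs of 13 domains, residual ≤ 4e-15).
Registered entry points (∀-telescopes): `s4_dart_shared_neg`, `s4_flank_direction`, `s4_flank_phase`.

Sources: H. Duminil-Copin, S. Smirnov, *The connective constant of the honeycomb lattice equals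
`√(2+√2)`*, Ann. of Math. 175 (2012) 1653–1665 (arXiv:1007.0575), §3 (boundary windings); the stub
report `STUB-REPORT-noBranching.md` of this line (§2, S4).
-/

noncomputable section

open Complex
open Literature.Probability.LatticeModels Literature.Probability.RandomPlanarGeometry
open Literature.Probability.RandomPlanarGeometry.SAW
open Literature.Barriers.CriticalPhenomena Literature.Barriers.CriticalPhenomena.HexKernel

namespace Summit.CriticalPhenomena.SAWScalingLimit.Cruxes.QCIdentification.EightFifthsPrimitive

namespace NB

/-! ### The corner of `face s l` at the site `s` -/

/-- The index of the corner of the triangle `Δ_{face s l}` at the site `s`, in the labelling of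
`cornerAngle`: `cornerAngle F (face s l) (arcCornerIdx l)` is the image angle at `s`. -/
def arcCornerIdx : Fin 6 → Fin 3 := ![1, 0, 2, 1, 0, 2]

/-- **The corner `arcCornerIdx l` of `face s l` sits at `s`**: `triVert (face s l) (arcCornerIdx l + 1) = s`
(`Dev.triVert v k`, `k : Fin 3`, the counterclockwise vertices of `Δ_v`, the side `dart F v k` running
from `triVert v k` to `triVert v (k+1)`). -/
theorem triVert_face_arcCornerIdx (s : Site 2) (l : Fin 6) :
    Dev.triVert (face s l) (arcCornerIdx l + 1) = s := by
  fin_cases l <;> simp [Dev.triVert, face, arcCornerIdx]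
  abel

/-- **Conversely, every corner is a hexagon corner**: the corner `k` of any face `v` (at the site
`triVert v (k+1)`) is the corner `arcCornerIdx l` of `v = face (triVert v (k+1)) l` for some `l` — the
regrouping dictionary `(v, k) ↔ (s, l)` of corners by sites. -/
theorem s4_exists_face_eq_of_corner (v : HexVertex) (k : Fin 3) :
    ∃ l : Fin 6, face (Dev.triVert v (k + 1)) l = v ∧ arcCornerIdx l = k := by
  obtain ⟨x, t⟩ := v
  fin_cases t <;> fin_cases k
  · exact ⟨4, by simp [Dev.triVert, face], rfl⟩
  · exact ⟨0, by simp [Dev.triVert, face], rfl⟩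
  · exact ⟨2, by simp [Dev.triVert, face], rfl⟩
  · exact ⟨1, by simp [Dev.triVert, face], rfl⟩
  · exact ⟨3, by simp [Dev.triVert, face]; abel, rfl⟩
  · exact ⟨5, by simp [Dev.triVert, face], rfl⟩

/-- The first side of the corner at `s` crosses the spoke shared with the NEXT hexagon face:
`hexNbr (face s l) (arcCornerIdx l) = face s (l + 1)`. -/
theorem hexNbr_face_arcCornerIdx (s : Site 2) (l : Fin 6) :
    hexNbr (face s l) (arcCornerIdx l) = face s (l + 1) := by
  fin_cases l <;> simp [hexNbr, face, arcCornerIdx]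
  abel

/-- The second side of the corner at `s` crosses the spoke shared with the PREVIOUS hexagon face:
`hexNbr (face s l) (arcCornerIdx l + 1) = face s (l - 1)`. -/
theorem hexNbr_face_arcCornerIdx_succ (s : Site 2) (l : Fin 6) :
    hexNbr (face s l) (arcCornerIdx l + 1) = face s (l - 1) := by
  fin_cases l <;> simp [hexNbr, face, arcCornerIdx]
  abel

/-! ### Shared darts and flank darts -/

/-- **The two darts through one hexagon edge are opposite (registered).** For every mid-edge function
`F`, the dart of `face s (l+1)` towards `face s l` is minus the dart of `face s l` towards
`face s (l+1)` (both are `± ½ (c_{l+1} - c_l) · F` of the same mid-edge). -/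
theorem s4_dart_shared_neg : ∀ (F : Sym2 HexVertex → ℂ) (s : Site 2) (l : Fin 6), dart F (HexKernel.face s (l + 1)) (arcCornerIdx (l + 1) + 1) = -dart F (HexKernel.face s l) (arcCornerIdx l) := by
  intro F s l
  rw [dart, dart, hexNbr_face_arcCornerIdx_succ, add_sub_cancel_right, hexNbr_face_arcCornerIdx]
  have e : s(face s (l + 1), face s l) = s(face s l, face s (l + 1)) := Sym2.eq_swap
  rw [e, hexMidpoint_mk]
  ring

/-- The flank dart `g_out` explicitly: the dart of the first arc face `face s (j+1)` through
`p_out = {face s j, face s (j+1)}` is `½ (c(face s j) - c(face s (j+1))) · F(p_out)`. -/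
theorem s4_flank_dart_out (F : Sym2 HexVertex → ℂ) (s : Site 2) (j : Fin 6) :
    dart F (face s (j + 1)) (arcCornerIdx (j + 1) + 1) =
      ((1 / 2 : ℝ) : ℂ) * (hexCenter (face s j) - hexCenter (face s (j + 1))) *
        F s(face s j, face s (j + 1)) := by
  rw [dart, hexNbr_face_arcCornerIdx_succ, add_sub_cancel_right]
  have e : s(face s (j + 1), face s j) = s(face s j, face s (j + 1)) := Sym2.eq_swap
  rw [e, hexMidpoint_mk]
  push_cast
  ring

/-- The flank dart `g_in` explicitly: the dart of the last arc face `face s (j+m)` through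
`p_in = {face s (j+1+m), face s (j+m)}` is `½ (c(face s (j+1+m)) - c(face s (j+m))) · F(p_in)`. -/
theorem s4_flank_dart_in (F : Sym2 HexVertex → ℂ) (s : Site 2) (j m : Fin 6) :
    dart F (face s (j + m)) (arcCornerIdx (j + m)) =
      ((1 / 2 : ℝ) : ℂ) * (hexCenter (face s (j + 1 + m)) - hexCenter (face s (j + m))) *
        F s(face s (j + 1 + m), face s (j + m)) := by
  rw [dart, hexNbr_face_arcCornerIdx, show j + m + 1 = j + 1 + m by abel]
  have e : s(face s (j + m), face s (j + 1 + m)) = s(face s (j + 1 + m), face s (j + m)) :=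
    Sym2.eq_swap
  rw [e, hexMidpoint_mk]
  push_cast
  ring

/-! ### Flank geometry -/

/-- **Hexagon edges turn by `ζ` per step**: `c(face s (j+1+n)) - c(face s (j+n)) =
ζ^n · (c(face s (j+1)) - c(face s j))` (`n : ℕ` through `HV.fin6`). -/
theorem s4_center_face_arc_sub (s : Site 2) (j : Fin 6) : ∀ n : ℕ,
    hexCenter (face s (j + 1 + HV.fin6 n)) - hexCenter (face s (j + HV.fin6 n)) =
      triZeta ^ n * (hexCenter (face s (j + 1)) - hexCenter (face s j))
  | 0 => by simp
  | n + 1 => by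
    have e1 : j + 1 + HV.fin6 (n + 1) = j + 1 + HV.fin6 n + 1 := by rw [HV.fin6_succ]; abel
    have e2 : j + HV.fin6 (n + 1) = j + 1 + HV.fin6 n := by rw [HV.fin6_succ]; abel
    have e3 : j + HV.fin6 n = j + 1 + HV.fin6 n - 1 := by abel
    rw [e1, e2, StepLaw.center_face_succ_sub, ← e3, s4_center_face_arc_sub s j n, pow_succ]
    ring

/-- `arg ζ^k = k·π/3` as an angle. -/
theorem s4_arg_triZeta_pow_coe (k : ℕ) :
    (arg (triZeta ^ k) : Real.Angle) = ((k * (Real.pi / 3) : ℝ) : Real.Angle) := by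
  have h : triZeta ^ k = Complex.exp ((k * (Real.pi / 3) : ℝ) * Complex.I) := by
    rw [triZeta, ← Complex.exp_nat_mul]
    congr 1
    push_cast
    ring
  rw [h, HV.arg_exp_mul_I_coe]

/-- **S4 (b), flank geometry (registered).** Around any site `s`, the direction of the flank
vector `c(face s j) - c(face s (j+1))` (pointing out of the arc through `p_out`) and that of
`c(face s (j+1+m)) - c(face s (j+m))` (out through `p_in`) differ by the exterior angle
`τ_m = π - m·π/3` modulo `2π` — the same step as the boundary winding law
`StepLaw.sl_boundary_winding_step`. -/
theorem s4_flank_direction : ∀ (s : Site 2) (j m : Fin 6), ((Complex.arg (hexCenter (HexKernel.face s j) - hexCenter (HexKernel.face s (j + 1))) - Complex.arg (hexCenter (HexKernel.face s (j + 1 + m)) - hexCenter (HexKernel.face s (j + m))) : ℝ) : Real.Angle) = ((Real.pi - (m : ℕ) * (Real.pi / 3) : ℝ) : Real.Angle) := by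
  intro s j m
  have q := s4_center_face_arc_sub s j (m : ℕ)
  rw [show HV.fin6 (m : ℕ) = m from Fin.ext (StepLaw.val_fin6_of_lt m.isLt)] at q
  set w := hexCenter (face s j) - hexCenter (face s (j + 1)) with hw
  have hw0 : w ≠ 0 := sub_ne_zero.2 (hexCenter_ne_of_adj (StepLaw.adj_face_succ s j))
  have hz3 : triZeta ^ 3 = -1 := by rw [HV.triZeta_eq_omg, HV.omg_pow_three]
  have q' : hexCenter (face s (j + 1 + m)) - hexCenter (face s (j + m)) =
      triZeta ^ ((m : ℕ) + 3) * w := by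
    rw [q, pow_add, hz3, hw]
    ring
  have hζ : triZeta ^ ((m : ℕ) + 3) ≠ 0 :=
    pow_ne_zero _ (by rw [HV.triZeta_eq_omg]; exact HV.omg_ne_zero)
  rw [Real.Angle.coe_sub, q', Complex.arg_mul_coe_angle hζ hw0, s4_arg_triZeta_pow_coe,
    show ∀ x y : Real.Angle, x - (y + x) = -y from fun x y => by abel, ← Real.Angle.coe_neg]
  refine (Real.Angle.angle_eq_iff_two_pi_dvd_sub).2 ⟨-1, ?_⟩
  push_cast
  ring

/-- **Flank phases (registered).** For every mid-edge function `F` with non-zero flank values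
`F(p_out)`, `F(p_in)`, the flank darts satisfy
`arg g_out - arg g_in ≡ (π - m·π/3) + (arg F(p_out) - arg F(p_in))` (mod `2π`). -/
theorem s4_flank_phase : ∀ (F : Sym2 HexVertex → ℂ) (s : Site 2) (j m : Fin 6), F s(HexKernel.face s j, HexKernel.face s (j + 1)) ≠ 0 → F s(HexKernel.face s (j + 1 + m), HexKernel.face s (j + m)) ≠ 0 → (Complex.arg (dart F (HexKernel.face s (j + 1)) (arcCornerIdx (j + 1) + 1)) : Real.Angle) - (Complex.arg (dart F (HexKernel.face s (j + m)) (arcCornerIdx (j + m))) : Real.Angle) = ((Real.pi - (m : ℕ) * (Real.pi / 3) : ℝ) : Real.Angle) + ((Complex.arg (F s(HexKernel.face s j, HexKernel.face s (j + 1))) : Real.Angle) - (Complex.arg (F s(HexKernel.face s (j + 1 + m), HexKernel.face s (j + m))) : Real.Angle)) := by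
  intro F s j m hout hin
  have ho : hexCenter (face s j) - hexCenter (face s (j + 1)) ≠ 0 :=
    sub_ne_zero.2 (hexCenter_ne_of_adj (StepLaw.adj_face_succ s j))
  have hi : hexCenter (face s (j + 1 + m)) - hexCenter (face s (j + m)) ≠ 0 := by
    have h := hexCenter_ne_of_adj (StepLaw.adj_face_succ s (j + m))
    rw [show j + m + 1 = j + 1 + m by abel] at h
    exact sub_ne_zero.2 h.symm
  have half : (0 : ℝ) < 1 / 2 := by norm_num
  rw [s4_flank_dart_out, s4_flank_dart_in, mul_assoc, mul_assoc, Complex.arg_real_mul _ half,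
    Complex.arg_real_mul _ half, Complex.arg_mul_coe_angle ho hout, Complex.arg_mul_coe_angle hi hin,
    ← s4_flank_direction s j m, Real.Angle.coe_sub]
  abel

end NB

end Summit.CriticalPhenomena.SAWScalingLimit.Cruxes.QCIdentification.EightFifthsPrimitive
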